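import Literature.AlgebraicGeometry.Resolution.AlterationsSingularComponents
import Literature.AlgebraicGeometry.Resolution.AlterationsFormalNodesSing
import Mathlib.RingTheory.Ideal.GoingDown
import Mathlib.RingTheory.Flat.Stability
import Mathlib.RingTheory.KrullDimension.Regular
import Mathlib.AlgebraicGeometry.AlgClosed.Basic
import HarnessLib

/-!
# Glue for de Jong 1996, 3.5 [B5]: primes of `𝒪_{X,x}` and points of `X`; components of the
# singular locus read in a local ring; residue fields at closed points

Topic: `Literature/AlgebraicGeometry/Resolution`. Support file (all statements [folklore] or
standard, all PROVED) for the proof of the named fact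
`DeJong1996CodimThreeSingularComponentsFormal` (`AlterationsSingularComponents.lean`) from the
split nodal structure with the trace of `Sing(f)` (`DeJong1996SplitNodalStructureSing`,
`AlterationsFormalNodesSing.lean`). The analysis of 3.5 takes place in the complete local ring
`𝒪̂_{X,x}`; this file supplies the dictionary back to the scheme:

* `Ideal.under_eq_of_mem_minimalPrimes_map` — going down: a minimal prime of `𝔭S` lies over
  `𝔭` (for `S` flat over `R`, e.g. `𝒪_{X,x} → 𝒪̂_{X,x}`);
* `RingHom.injective_of_surjective_of_ringKrullDim_le` — a surjection of a Noetherian local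
  domain onto a domain of at least the same dimension is injective;
* `ringEquiv_stalk_fromSpec_localization`, `exists_specializes_ringEquiv_localization` — **a
  prime `𝔮` of `𝒪_{X,x}` is a point `x'` of `X` generising `x`, with `𝒪_{X,x'} ≅ (𝒪_{X,x})_𝔮`**
  (on an affine open `Spec A ∋ x`, `(A_𝔭)_𝔮 = A_{𝔮 ∩ A}`);
* `stalkIdeal_vanishingIdeal_component` — **an irreducible component `E ∋ x` of the (closed)
  singular locus read in `𝒪_{X,x}`**: the stalk `P = I_{E,x}` of its ideal is a prime of
  `𝒪_{X,x}` with `(𝒪_{X,x})_P` not regular, and every prime `𝔮 ⊆ P` with `(𝒪_{X,x})_𝔮` not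
  regular equals `P` (the generic point of `E` is a maximal point of `Sing(X)`);
* `exists_stalkMap_sub_mem_maximalIdeal` — at a closed point `x` of a morphism `f : X → Y` of
  schemes of finite type over an algebraically closed field with `f x` closed, every germ at
  `x` is congruent modulo `𝔪ₓ` to the image of a germ at `f x` (`κ(f x) → κ(x)` is onto, both
  being the ground field).
-/

noncomputable section

open CategoryTheory CategoryTheory.Limits AlgebraicGeometry TopologicalSpace Topology

namespace Literature.AlgebraicGeometry.Resolution

universe u

open IsLocalRing Scheme.IdealSheafData

/-! ## Going down: minimal primes of an extended prime -/

/-- **A minimal prime of `𝔭S` lies over `𝔭`** when going down holds for `R → S` (e.g. `S`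
flat over `R`): if `𝔔` is minimal over `𝔭S` then `𝔔 ∩ R = 𝔭` — by going down a prime
`𝔔' ⊆ 𝔔` lies over `𝔭`, it contains `𝔭S`, so `𝔔' = 𝔔`. [folklore] -/
theorem Ideal.under_eq_of_mem_minimalPrimes_map {R S : Type*} [CommRing R] [CommRing S]
    [Algebra R S] [Algebra.HasGoingDown R S] (p : Ideal R) [p.IsPrime] {Q : Ideal S}
    (hQ : Q ∈ (p.map (algebraMap R S)).minimalPrimes) : Q.under R = p := by
  haveI hQp : Q.IsPrime := hQ.1.1
  have hpQ : p ≤ Q.under R := by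
    rw [Ideal.under_def, ← Ideal.map_le_iff_le_comap]
    exact hQ.1.2
  obtain ⟨Q', hQ'Q, hQ'p, hlies⟩ :=
    Ideal.exists_ideal_le_liesOver_of_le (p := p) (q := Q.under R) Q hpQ
  have hmap : p.map (algebraMap R S) ≤ Q' := by
    rw [Ideal.map_le_iff_le_comap, ← Ideal.under_def, ← hlies.over]
  have hQQ' : Q = Q' := le_antisymm (hQ.2 ⟨hQ'p, hmap⟩ hQ'Q) hQ'Q
  rw [hQQ']
  exact hlies.over.symm

/-! ## Surjections of local domains of the same dimension -/

/-- In `WithBot ℕ∞`: a finite non-negative `d` does not satisfy `d + 1 ≤ d`. [folklore] -/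
theorem WithBotENat.not_add_one_le_self {d : WithBot ℕ∞} (h0 : 0 ≤ d) (htop : d + 1 < ⊤) :
    ¬ d + 1 ≤ d := by
  intro h
  induction d using WithBot.recBotCoe with
  | bot => exact absurd h0 (by simp)
  | coe e =>
    induction e using ENat.recTopCoe with
    | top =>
      have htop' : (((⊤ : ℕ∞) : WithBot ℕ∞) + 1) = ⊤ := by
        rw [← WithBot.coe_one, ← WithBot.coe_add, top_add, WithBot.coe_top]
      rw [htop'] at htop
      exact absurd htop (lt_irrefl _)
    | coe n =>
      have h' : ((n + 1 : ℕ) : WithBot ℕ∞) ≤ (n : ℕ) := by exact_mod_cast h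
      have h'' : n + 1 ≤ n := by exact_mod_cast h'
      omega

/-- **A surjection of a Noetherian local domain onto a domain of at least the same (Krull)
dimension is injective**: if its (prime) kernel `𝔨` contains `r ≠ 0` then
`dim S ≤ dim N = dim S/𝔨 ≤ dim S/(r) = dim S - 1`. [folklore] -/
theorem RingHom.injective_of_surjective_of_ringKrullDim_le {S N : Type*} [CommRing S]
    [CommRing N] [IsDomain S] [IsLocalRing S] [IsNoetherianRing S] [Nontrivial N] (ψ : S →+* N)
    (hψ : Function.Surjective ψ) (hdim : ringKrullDim S ≤ ringKrullDim N) :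
    Function.Injective ψ := by
  rw [RingHom.injective_iff_ker_eq_bot]
  by_contra hker
  obtain ⟨r, hr, hr0⟩ := Submodule.exists_mem_ne_zero_of_ne_bot hker
  have hkertop : RingHom.ker ψ ≠ ⊤ := RingHom.ker_ne_top ψ
  have hrm : r ∈ maximalIdeal S := IsLocalRing.le_maximalIdeal hkertop hr
  -- `dim N = dim S/𝔨 ≤ dim S/(r)`
  let e := RingHom.quotientKerEquivOfSurjective hψ
  have h1 : ringKrullDim N = ringKrullDim (S ⧸ RingHom.ker ψ) :=
    (ringKrullDim_eq_of_ringEquiv e).symm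
  have hle : Ideal.span {r} ≤ RingHom.ker ψ := (Ideal.span_singleton_le_iff_mem _).mpr hr
  have h2 : ringKrullDim (S ⧸ RingHom.ker ψ) ≤ ringKrullDim (S ⧸ Ideal.span {r}) :=
    ringKrullDim_le_of_surjective (Ideal.Quotient.factor hle) (Ideal.Quotient.factor_surjective hle)
  have h3 : ringKrullDim (S ⧸ Ideal.span {r}) + 1 = ringKrullDim S :=
    ringKrullDim_quotient_span_singleton_succ_eq_ringKrullDim_of_mem_nonZeroDivisors
      (mem_nonZeroDivisors_of_ne_zero hr0) hrm
  -- `d + 1 ≤ d` for `d = dim S/(r)`, finite and `≥ 0`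
  set d := ringKrullDim (S ⧸ Ideal.span {r}) with hd
  have hbad : d + 1 ≤ d := by
    calc d + 1 = ringKrullDim S := h3
      _ ≤ ringKrullDim N := hdim
      _ = ringKrullDim (S ⧸ RingHom.ker ψ) := h1
      _ ≤ d := h2
  have hspan_ne : Ideal.span {r} ≠ ⊤ := fun h => hkertop (top_le_iff.mp (h ▸ hle))
  haveI : Nontrivial (S ⧸ Ideal.span {r}) := Ideal.Quotient.nontrivial_iff.mpr hspan_ne
  have h0 : 0 ≤ d := ringKrullDim_nonneg_of_nontrivial
  have htop : d + 1 < ⊤ := by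
    rw [h3]
    exact ringKrullDim_lt_top
  exact WithBotENat.not_add_one_le_self h0 htop hbad

/-! ## Primes of `𝒪_{X,x}` are points generising `x` -/

section Stalk

variable {X : Scheme.{u}} {U : X.Opens} (hU : IsAffineOpen U) {x : X} (hxU : x ∈ U)

/-- A point of `Spec Γ(X, U)` maps into `U`. [folklore] -/
theorem fromSpec_mem_of_isAffineOpen (y : PrimeSpectrum Γ(X, U)) :
    (hU.fromSpec y : X) ∈ U := by
  have hr : (hU.fromSpec y : X) ∈ Set.range (hU.fromSpec : _ → X) := ⟨y, rfl⟩
  rwa [hU.range_fromSpec] at hr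

/-- The prime of `Γ(X, U)` of the point `fromSpec y` is `y`. [folklore] -/
theorem primeIdealOf_fromSpec_of_isAffineOpen (y : PrimeSpectrum Γ(X, U)) :
    hU.primeIdealOf ⟨hU.fromSpec y, fromSpec_mem_of_isAffineOpen hU y⟩ = y := by
  apply hU.fromSpec.isOpenEmbedding.injective
  rw [hU.fromSpec_primeIdealOf]

/-- **`𝒪_{X,x'} ≅ (𝒪_{X,x})_𝔮` for the point `x'` of the prime `𝔮 ∩ Γ(X, U)`** of an affine open
`U ∋ x`, `𝔮` a prime of `𝒪_{X,x} = Γ(X, U)_{𝔭ₓ}`: both sides are the localisation of `Γ(X, U)`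
at `𝔮 ∩ Γ(X, U)`. [folklore] -/
theorem ringEquiv_stalk_fromSpec_localization (q : Ideal (X.presheaf.stalk x))
    [q.IsPrime] :
    letI := TopCat.Presheaf.algebra_section_stalk X.presheaf (⟨x, hxU⟩ : U)
    Nonempty (X.presheaf.stalk (hU.fromSpec ⟨q.under Γ(X, U), inferInstance⟩) ≃+*
      Localization.AtPrime q) := by
  letI := TopCat.Presheaf.algebra_section_stalk X.presheaf (⟨x, hxU⟩ : U)
  haveI hlocx := hU.isLocalization_stalk ⟨x, hxU⟩
  let q₀ : Ideal Γ(X, U) := q.under Γ(X, U)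
  let y : PrimeSpectrum Γ(X, U) := ⟨q₀, inferInstance⟩
  have hy : (hU.fromSpec y : X) ∈ U := fromSpec_mem_of_isAffineOpen hU y
  letI := TopCat.Presheaf.algebra_section_stalk X.presheaf (⟨hU.fromSpec y, hy⟩ : U)
  haveI hlocy : IsLocalization.AtPrime (X.presheaf.stalk (hU.fromSpec y)) q₀ :=
    hU.isLocalization_stalk' y hy
  haveI : IsScalarTower Γ(X, U) (X.presheaf.stalk x) (Localization.AtPrime q) :=
    IsScalarTower.of_algebraMap_eq' rfl
  haveI hloc2 : IsLocalization.AtPrime (Localization.AtPrime q) q₀ :=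
    IsLocalization.isLocalization_isLocalization_atPrime_isLocalization
      (hU.primeIdealOf ⟨x, hxU⟩).asIdeal.primeCompl (Localization.AtPrime q) q
  exact ⟨(IsLocalization.algEquiv q₀.primeCompl (X.presheaf.stalk (hU.fromSpec y))
    (Localization.AtPrime q)).toRingEquiv⟩

/-- The point of `𝔮 ∩ Γ(X, U)` generises `x`. [folklore] -/
theorem fromSpec_under_specializes (q : Ideal (X.presheaf.stalk x)) [q.IsPrime] :
    letI := TopCat.Presheaf.algebra_section_stalk X.presheaf (⟨x, hxU⟩ : U)
    hU.fromSpec ⟨q.under Γ(X, U), inferInstance⟩ ⤳ x := by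
  letI := TopCat.Presheaf.algebra_section_stalk X.presheaf (⟨x, hxU⟩ : U)
  haveI hlocx := hU.isLocalization_stalk ⟨x, hxU⟩
  have hle : (⟨q.under Γ(X, U), inferInstance⟩ : PrimeSpectrum Γ(X, U)) ≤
      hU.primeIdealOf ⟨x, hxU⟩ := by
    change q.under Γ(X, U) ≤ (hU.primeIdealOf ⟨x, hxU⟩).asIdeal
    rw [← IsLocalization.AtPrime.under_maximalIdeal (X.presheaf.stalk x)
      (hU.primeIdealOf ⟨x, hxU⟩).asIdeal]
    exact Ideal.comap_mono (IsLocalRing.le_maximalIdeal (Ideal.IsPrime.ne_top ‹_›))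
  have hsp := ((PrimeSpectrum.le_iff_specializes _ _).mp hle).map hU.fromSpec.continuous
  rwa [hU.fromSpec_primeIdealOf ⟨x, hxU⟩] at hsp

end Stalk

/-- **A prime `𝔮` of the local ring `𝒪_{X,x}` is a point `x'` of `X` generising `x`, with
`𝒪_{X,x'} ≅ (𝒪_{X,x})_𝔮`.** [folklore] -/
theorem exists_specializes_ringEquiv_localization {X : Scheme.{u}} (x : X)
    (q : Ideal (X.presheaf.stalk x)) [q.IsPrime] :
    ∃ x' : X, x' ⤳ x ∧ Nonempty (X.presheaf.stalk x' ≃+* Localization.AtPrime q) := by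
  obtain ⟨U, hU, hxU, -⟩ :=
    exists_isAffineOpen_mem_and_subset (X := X) (x := x) (U := ⊤) (Opens.mem_top x)
  exact ⟨_, fromSpec_under_specializes hU hxU q, ringEquiv_stalk_fromSpec_localization hU hxU q⟩

/-! ## A component of the singular locus read in a local ring -/

/-- An irreducible component `E` of a subspace `S ⊆ X` is maximal among the irreducible subsets
of `X` contained in `S`: `W = E` for every irreducible `W` with `E ⊆ W ⊆ S`. [folklore] -/
theorem eq_image_of_mem_irreducibleComponents_subtype {α : Type*} [TopologicalSpace α]
    {S : Set α} {E : Set ↥S} (hE : E ∈ irreducibleComponents ↥S) {W : Set α}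
    (hW : IsIrreducible W) (hWS : W ⊆ S) (hEW : Subtype.val '' E ⊆ W) : W = Subtype.val '' E := by
  -- `W = val '' W'` with `W' ⊆ S` the irreducible range of the inclusion `W → S`
  let i : ↥W → ↥S := fun w => ⟨w.1, hWS w.2⟩
  have hi : Continuous i := continuous_induced_rng.mpr (continuous_subtype_val)
  haveI := Subtype.irreducibleSpace hW
  have hW'irr : IsIrreducible (Set.range i) := by
    rw [← Set.image_univ]
    exact (IrreducibleSpace.isIrreducible_univ ↥W).image i hi.continuousOn
  have hrange : Subtype.val '' Set.range i = W := by
    ext a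
    simp only [Set.mem_image, Set.mem_range]
    constructor
    · rintro ⟨_, ⟨w, rfl⟩, rfl⟩
      exact w.2
    · intro ha
      exact ⟨⟨a, hWS ha⟩, ⟨⟨a, ha⟩, rfl⟩, rfl⟩
  have hEW' : E ⊆ Set.range i := by
    intro s hs
    have : (s : α) ∈ W := hEW ⟨s, hs, rfl⟩
    exact ⟨⟨s, this⟩, Subtype.ext rfl⟩
  have hW'E : Set.range i ⊆ E := hE.2 hW'irr hEW'
  rw [← hrange]
  exact congrArg _ (le_antisymm hW'E hEW')

/-- **An irreducible component of the singular locus through `x`, read in `𝒪_{X,x}`.** Let the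
singular locus `Sing = {x | 𝒪_{X,x} not regular}` of the scheme `X` be closed, `E` an
irreducible component of (the subspace) `Sing`, and `x` a point of its closure `Ē` (`= E`).
Then the stalk `P = I_{E,x}` at `x` of the ideal sheaf of the reduced structure on `Ē` is a
prime of `𝒪_{X,x}` (the prime of the generic point `ξ` of `E`), the local ring `(𝒪_{X,x})_P =
𝒪_{X,ξ}` is not regular, and every prime `𝔮 ⊆ P` of `𝒪_{X,x}` with `(𝒪_{X,x})_𝔮` not
regular equals `P`: `𝔮` is a point `η` of `Sing` generising `ξ`, and `E = cl{ξ} ⊆ cl{η}`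
irreducible inside `Sing` forces `cl{η} = E`. [folklore] -/
theorem stalkIdeal_vanishingIdeal_component {X : Scheme.{u}}
    (hSc : IsClosed ({x : X | ¬ IsRegularLocalRing (X.presheaf.stalk x)} : Set X))
    {E : Set ↥({x : X | ¬ IsRegularLocalRing (X.presheaf.stalk x)} : Set X)}
    (hE : E ∈ irreducibleComponents ↥({x : X | ¬ IsRegularLocalRing (X.presheaf.stalk x)} : Set X))
    {x : X} (hx : x ∈ closure (Subtype.val '' E)) :
    ∃ hP : (stalkIdeal (vanishingIdeal ⟨closure (Subtype.val '' E), isClosed_closure⟩) x).IsPrime,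
      ¬ IsRegularLocalRing (@Localization.AtPrime _ _
          (stalkIdeal (vanishingIdeal ⟨closure (Subtype.val '' E), isClosed_closure⟩) x) hP) ∧
      ∀ (q : Ideal (X.presheaf.stalk x)) (hq : q.IsPrime),
        q ≤ stalkIdeal (vanishingIdeal ⟨closure (Subtype.val '' E), isClosed_closure⟩) x →
        ¬ IsRegularLocalRing (@Localization.AtPrime _ _ q hq) →
          q = stalkIdeal (vanishingIdeal ⟨closure (Subtype.val '' E), isClosed_closure⟩) x := by
  classical
  -- the closed irreducible subset `Z = E` of `X`, maximal among irreducible subsets of `Sing`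
  have hEcl : IsClosed (Subtype.val '' E) := by
    have h1 : IsClosed E := isClosed_of_mem_irreducibleComponents _ hE
    obtain ⟨C, hC, hCE⟩ := isClosed_induced_iff.mp h1
    have : Subtype.val '' E = ({x : X | ¬ IsRegularLocalRing (X.presheaf.stalk x)} : Set X) ∩ C := by
      rw [← hCE, Subtype.image_preimage_coe]
    rw [this]
    exact hSc.inter hC
  set Z : Set X := closure (Subtype.val '' E) with hZdef
  have hZE : Z = Subtype.val '' E := hEcl.closure_eq
  have hZS : Z ⊆ ({x : X | ¬ IsRegularLocalRing (X.presheaf.stalk x)} : Set X) := by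
    rw [hZE]
    rintro _ ⟨z, -, rfl⟩
    exact z.2
  have hZirr : IsIrreducible Z := by
    rw [hZE]
    exact hE.1.image _ continuous_subtype_val.continuousOn
  have hZmax : ∀ W : Set X, IsIrreducible W →
      W ⊆ ({x : X | ¬ IsRegularLocalRing (X.presheaf.stalk x)} : Set X) → Z ⊆ W → W = Z :=
    fun W hW hWS hZW => by
      rw [hZE] at hZW ⊢
      exact eq_image_of_mem_irreducibleComponents_subtype hE hW hWS hZW
  -- an affine chart `U = Spec A ∋ x`; the closed irreducible `T = Z ∩ U ⊆ Spec A`, prime `𝔭_T`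
  obtain ⟨U, hU, hxU, -⟩ :=
    exists_isAffineOpen_mem_and_subset (X := X) (x := x) (U := ⊤) (Opens.mem_top x)
  letI := TopCat.Presheaf.algebra_section_stalk X.presheaf (⟨x, hxU⟩ : U)
  haveI hlocx := hU.isLocalization_stalk ⟨x, hxU⟩
  set T : Set (PrimeSpectrum Γ(X, U)) := (hU.fromSpec : _ → X) ⁻¹' Z with hTdef
  have hTcl : IsClosed T := isClosed_closure.preimage hU.fromSpec.continuous
  have hxZ : x ∈ Z := hx
  have hTirr : IsIrreducible T :=
    hZirr.preimage hU.fromSpec.isOpenEmbedding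
      ⟨x, hxZ, ⟨hU.primeIdealOf ⟨x, hxU⟩, hU.fromSpec_primeIdealOf ⟨x, hxU⟩⟩⟩
  set pT : Ideal Γ(X, U) := PrimeSpectrum.vanishingIdeal T with hpTdef
  haveI hpT : pT.IsPrime := PrimeSpectrum.isIrreducible_iff_vanishingIdeal_isPrime.mp hTirr
  have hTeq : T = PrimeSpectrum.zeroLocus (pT : Set Γ(X, U)) := by
    rw [hpTdef, PrimeSpectrum.zeroLocus_vanishingIdeal_eq_closure, hTcl.closure_eq]
  have hmemT : ∀ w : PrimeSpectrum Γ(X, U), w ∈ T ↔ pT ≤ w.asIdeal := fun w => by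
    rw [hTeq, PrimeSpectrum.mem_zeroLocus, SetLike.coe_subset_coe]
  -- the ideal of `Z` over `U` is `𝔭_T`, so `P = 𝔭_T · 𝒪_{X,x}`
  have hIU : (vanishingIdeal ⟨Z, isClosed_closure⟩ : X.IdealSheafData).ideal ⟨U, hU⟩ = pT := by
    rw [vanishingIdeal_ideal]
    rfl
  set P := stalkIdeal (vanishingIdeal ⟨Z, isClosed_closure⟩) x with hPdef
  have hP : P = pT.map (algebraMap Γ(X, U) (X.presheaf.stalk x)) := by
    rw [hPdef, stalkIdeal_eq_map_germ _ ⟨U, hU⟩ hxU, hIU]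
    rfl
  -- `𝔭_T ⊆ 𝔭ₓ`
  set px := hU.primeIdealOf ⟨x, hxU⟩ with hpxdef
  have hpxT : px ∈ T := by
    change hU.fromSpec px ∈ Z
    rw [hpxdef, hU.fromSpec_primeIdealOf ⟨x, hxU⟩]
    exact hxZ
  have hle : pT ≤ px.asIdeal := (hmemT px).mp hpxT
  have hdisj : Disjoint (px.asIdeal.primeCompl : Set Γ(X, U)) (pT : Set Γ(X, U)) :=
    Set.disjoint_left.mpr fun a ha haT => ha (hle haT)
  haveI hPprime : P.IsPrime := by
    rw [hP]
    exact IsLocalization.isPrime_of_isPrime_disjoint px.asIdeal.primeCompl _ pT hpT hdisj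
  have hPunder : P.under Γ(X, U) = pT := by
    rw [hP]
    exact IsLocalization.under_map_of_isPrime_disjoint px.asIdeal.primeCompl _ hpT hdisj
  -- the generic point `ξ` of `Z`: `(𝒪_{X,x})_P ≅ 𝒪_{X,ξ}`, not regular
  have key : ∀ (q : Ideal (X.presheaf.stalk x)) [q.IsPrime],
      ¬ IsRegularLocalRing (Localization.AtPrime q) ↔
        hU.fromSpec ⟨q.under Γ(X, U), inferInstance⟩ ∈
          ({x : X | ¬ IsRegularLocalRing (X.presheaf.stalk x)} : Set X) := by
    intro q _
    obtain ⟨e⟩ := ringEquiv_stalk_fromSpec_localization hU hxU q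
    change _ ↔ ¬ IsRegularLocalRing _
    exact ⟨fun h h' => h (IsRegularLocalRing.of_ringEquiv e),
      fun h h' => h (IsRegularLocalRing.of_ringEquiv e.symm)⟩
  have hξZ : hU.fromSpec ⟨P.under Γ(X, U), inferInstance⟩ ∈ Z := by
    have h1 : (⟨P.under Γ(X, U), inferInstance⟩ : PrimeSpectrum Γ(X, U)) ∈ T := by
      rw [hmemT]
      exact hPunder.ge
    exact h1
  refine ⟨hPprime, (key P).mpr (hZS hξZ), fun q hq hqP hqreg => ?_⟩
  -- a singular prime `𝔮 ⊆ P` is `P`: its point `η` has `Z ⊆ cl{η} ⊆ S`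
  haveI := hq
  set q₀ : Ideal Γ(X, U) := q.under Γ(X, U) with hq₀def
  set η : X := hU.fromSpec ⟨q₀, inferInstance⟩ with hηdef
  have hηS : η ∈ ({x : X | ¬ IsRegularLocalRing (X.presheaf.stalk x)} : Set X) :=
    (key q).mp hqreg
  have hq₀le : q₀ ≤ pT := by
    rw [← hPunder]
    exact Ideal.comap_mono hqP
  have hZη : Z ⊆ closure {η} := by
    -- `Z ⊆ cl(Z ∩ U)` and `Z ∩ U = fromSpec '' T ⊆ cl{η}` as `T ⊆ V(q₀) = cl{q₀}`
    have h1 : Z ⊆ closure (Z ∩ (U : Set X)) :=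
      subset_closure_inter_of_isPreirreducible_of_isOpen hZirr.isPreirreducible U.isOpen
        ⟨x, hxZ, hxU⟩
    have h2 : Z ∩ (U : Set X) ⊆ closure {η} := by
      rintro z ⟨hzZ, hzU⟩
      obtain ⟨w, rfl⟩ : z ∈ Set.range (hU.fromSpec : _ → X) := by rwa [hU.range_fromSpec]
      have hwT : w ∈ T := hzZ
      have hw : (⟨q₀, inferInstance⟩ : PrimeSpectrum Γ(X, U)) ⤳ w :=
        (PrimeSpectrum.le_iff_specializes _ _).mp (hq₀le.trans ((hmemT w).mp hwT))
      exact specializes_iff_mem_closure.mp (hw.map hU.fromSpec.continuous)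
    exact h1.trans ((closure_mono h2).trans isClosed_closure.closure_subset)
  have hclη : closure ({η} : Set X) = Z :=
    hZmax _ isIrreducible_singleton.closure (closure_minimal (Set.singleton_subset_iff.mpr hηS) hSc)
      hZη
  have hηZ : η ∈ Z := hclη ▸ subset_closure (Set.mem_singleton η)
  have hηT : (⟨q₀, inferInstance⟩ : PrimeSpectrum Γ(X, U)) ∈ T := hηZ
  have hq₀eq : q₀ = pT := le_antisymm hq₀le ((hmemT _).mp hηT)
  -- `q = q₀ · 𝒪_{X,x} = 𝔭_T · 𝒪_{X,x} = P`
  calc q = q₀.map (algebraMap Γ(X, U) (X.presheaf.stalk x)) :=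
        (IsLocalization.map_under px.asIdeal.primeCompl (X.presheaf.stalk x) q).symm
    _ = P := by rw [hq₀eq, ← hP]

/-! ## Residue fields at closed points over an algebraically closed field -/

/-- **`κ(f x) → κ(x)` is onto at a closed point over an algebraically closed field.** For
`f : X → Y` over `Spec k`, `k` algebraically closed, `X`, `Y` locally of finite type, and closed
points `x`, `f x`: every germ `r ∈ 𝒪_{X,x}` is congruent modulo `𝔪ₓ` to `f^#(a)` for some germ
`a ∈ 𝒪_{Y,f x}` — both residue fields are `k` (Mathlib's `residueFieldIsoBase`), so the map
`Spec κ(x) → Spec κ(f x)` over `Spec k` is an isomorphism. [folklore] -/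
theorem exists_stalkMap_sub_mem_maximalIdeal {k : Type u} [Field k] [IsAlgClosed k]
    {X Y : Scheme.{u}} (f : X ⟶ Y) (g : Y ⟶ Spec (.of k)) [LocallyOfFiniteType g]
    [LocallyOfFiniteType (f ≫ g)] {x : X} (hx : IsClosed ({x} : Set X))
    (hy : IsClosed ({f x} : Set Y)) (r : X.presheaf.stalk x) :
    ∃ a : Y.presheaf.stalk (f x), (f.stalkMap x).hom a - r ∈ maximalIdeal (X.presheaf.stalk x) := by
  -- `Spec κ(x) → Spec κ(f x)` is an isomorphism over `Spec k`
  have hiso : IsIso (Spec.map (f.residueFieldMap x)) := by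
    have h1 : Spec.map (f.residueFieldMap x) ≫ (Y.fromSpecResidueField (f x) ≫ g) =
        X.fromSpecResidueField x ≫ (f ≫ g) := by
      rw [← Category.assoc, Scheme.Hom.SpecMap_residueFieldMap_fromSpecResidueField,
        Category.assoc]
    rw [← SpecMap_residueFieldIsoBase_inv (f ≫ g) x hx,
      ← SpecMap_residueFieldIsoBase_inv g (f x) hy] at h1
    -- `Spec.map φ ≫ Spec.map e_y.inv = Spec.map e_x.inv` with the `e`'s isomorphisms
    have h2 : Spec.map (f.residueFieldMap x) =
        Spec.map (residueFieldIsoBase (f ≫ g) x hx).inv ≫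
          inv (Spec.map (residueFieldIsoBase g (f x) hy).inv) := by
      rw [← h1, Category.assoc, IsIso.hom_inv_id, Category.comp_id]
    rw [h2]
    infer_instance
  have hsurj : Function.Surjective (f.residueFieldMap x) := by
    haveI : IsIso (Scheme.Spec.map (f.residueFieldMap x).op) := hiso
    haveI : IsIso (f.residueFieldMap x).op :=
      Spec.fullyFaithful.isIso_of_isIso_map (f.residueFieldMap x).op
    haveI : IsIso (f.residueFieldMap x) := (isIso_op_iff _).mp inferInstance
    exact (ConcreteCategory.bijective_of_isIso (f.residueFieldMap x)).2
  -- lift along the residue maps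
  obtain ⟨c, hc⟩ := hsurj (X.residue x r)
  obtain ⟨a, rfl⟩ := Y.residue_surjective (f x) c
  refine ⟨a, ?_⟩
  have h3 : X.residue x ((f.stalkMap x).hom a) = X.residue x r := by
    rw [← hc]
    change (Y.residue (f x) ≫ f.residueFieldMap x) a = _
    rw [Scheme.residue_residueFieldMap]
    rfl
  rw [← Ideal.Quotient.eq]
  exact h3

end Literature.AlgebraicGeometry.Resolution

end
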